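import Literature.NumberTheory.EllipticCurves.Rank1Residual.Predicates
import Literature.NumberTheory.EllipticCurves.Kobayashi2003.SignedSelmer
import Literature.NumberTheory.EllipticCurves.IwasawaSelmer
import Literature.Barriers.BirchSwinnertonDyer.DescentDefectUnbounded
import Summits.BirchSwinnertonDyer.Rank1Residual.F1Sign2.LayerOneNormIndexFloorAtTwo
import HarnessLib

/-!
# Cell `bsd-f1-sign2` — descent lens (seat `-desc`) g6, MEMO-desc §14: the supersingular norm index at `2`
# up the cyclotomic `ℤ₂`-tower is the Jacobsthal number `J_N = (2^N − (−1)^N)/3`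

For `E/ℚ` with good SUPERSINGULAR reduction at `2` (`a₂ ∈ {0, ±2}`), `ℚ_{2,N} := ℚ₂(ζ_{2^{N+2}})⁺ · ` the
completion of the `N`-th layer `ℚ_N` of the cyclotomic `ℤ₂`-extension at its unique place over `2`
(totally ramified, `e = 2^N`, `f = 1`), the STEP NORM INDEX
`i₂^{(N)}(E) := dim_{𝔽₂} E(ℚ_{2,N−1}) / Tr_{N/N−1} E(ℚ_{2,N})` satisfies, for every `N ≥ 1` and independently of `a₂`,

  `i₂^{(N)}(E) = J_N = (2^N − (−1)^N)/3 = 1, 1, 3, 5, 11, 21, 43, …` (Jacobsthal numbers).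

STATUS / GRADE (numbers, not adjectives):
* DATA (two engines, BC5 witness): E1 (generic Honda engine over the tower ring, `a₂ ∈ {0, ±2}`, `N ≤ 7`: 21/21 rows
  `i = J_N`, files `g6/e1_out_N6.txt` sha16 52e7339816778550 (file; in-file table SHA16 026b1667f38ed39c), `g6/e1_out_N7.txt` sha16 3170ca77c83ffa3d (file; in-file table SHA16 482d0fb083dffed5)) and E2 (gp
  `ellformallog` on the minimal models of 11a1 (`a₂ = −2`), 19a1 (`a₂ = 0`), `[0,-1,1,-8,-7]` (`N = 75`, `a₂ = +2`),
  `[0,-1,1,-7,10]` (`N = 121`, `a₂ = 0`), `N ≤ 6`: 24/24 rows `i = J_N`; kit job j289452, `g6/e2_out_j289452.txt` sha16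
  85cf66aa07dd642f; CONTROL: the non-minimal model `[0,-1,0,-5,13] ≅ 11a3` scaled by `u = 2` gives the additive
  (`𝔾_a`) answer `i = 2^{N−1}` — the law is about `E(ℚ_{2,N})`, i.e. the minimal model's formal group).
* IN PRINT (special case, not beyond print): the exact value follows from Kramer–Tunnell, Compositio 46 (1982) §8
  [corpus: paper:url-f1c2eb36a995 p0034–p0037: Lemmas 8.9–8.12, 8.14, Prop. 8.15 and the remark after it ("`N_n` is the
  zero map when `a(ω)` is divisible by `3` and surjective otherwise"), Thm. 8.17 (parity)] specialised to `f = 1`,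
  `a(ω_N) = d(ℚ_{2,N}/ℚ_{2,N−1}) = 2^N + 1`, `3 v_F(a₁) ≥ a(ω)` automatic: `N` odd ⇒ `a = 3n`, `i = n = (2^N+1)/3`;
  `N` even ⇒ `a = 3n − 1`, `i = n − 1 = (2^N − 1)/3`. Parity `i` odd = Kramer 1981 Prop. 4 [corpus:
  paper:doi-10-1090-s0002-9947-1981-0597871-8 p0007] = Dokchitser–Dokchitser 2011 Thm. 5 [corpus: paper:arxiv-0906.1815 p0004]
  (`(Δ_min, ·)` with `Δ_min ≡ 5 mod 8`). `J_N = q_N(2) + [N odd]` with Kurihara's `q_N` [corpus: paper:url-3e548eeedfb3 p0006].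
* GLOBAL COROLLARY (in-print assembly: Kramer 1981 Thm. 1 [p0011] + `E(ℚ_{N−1})[2] = 0`, automatic at a supersingular `2`
  since `#Ẽ(𝔽₂)` is odd and `Ê[2] ≠ 0` needs `3 ∣ e = 2^{N−1}`): `dim_{𝔽₂} Sel₂(E/ℚ_N) ≥ J_N` for every `N ≥ 1`, with
  EQUALITY `dim Sel₂(E/ℚ_N) = Σ_v i_v` whenever `Sel₂(E/ℚ_{N−1}) = 0` [Remark, p0012].
* LINK to the registered line `Cruxes/SupersingularRankZeroAtTwo/Lines/signed_halves_two.lean` (stmt-BirchSwinnertonDyer-19097),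
  stub `stub_pmFlatDataV9`, local clauses (levels · trace relation `Tr c_{n+1} = a₂ c_n − c_{n−1}` · level-`0` generation):
  Kobayashi/Sprung-type generation `Ê(𝔪_N) = ℤ₂[G_N] c_N + ℤ₂[G_N] c_{N−1}` with that trace relation forces the rank pattern
  `r_m = 2^m − r_{m−1}`, `r_0 = 1`, i.e. `r_m = J_{m+1}`, hence the step index `2^{J_N}` for every `a₂` — the law below is
  the numerical consistency statement those clauses must reproduce at `2` (crux idea filed on that item, not a route).
Nothing is asserted: `def … : Prop` candidates + small kernel-checked lemmas on `J_N`. PARTITION: none moved.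

TYPER FILING (seat `bsd-f1-sign2-ty` g2, T-desc-6; CANDIDATES.md rows L14-loc / L14-loc′ / L14-glob / L14-glob′): bodies VERBATIM
from `HOME/MEMO-desc-data/g6/Sketch-v6.lean` f540a9a8adc6ad82 (-desc g6 final; rc 0 / 0 sorries; 4 Props + `jacobsthal` + 8
proved lemmas; BC7 probe 4/4 CLEAN); namespace shortened to `…F1Sign2` (the sketch's `…F1Sign2.DescG6`), so the tree's
`inertEvenMultPrimes` (p563609) is used in-namespace; the sketch's import of the route file `…Theses.ByReductionTypeAtTwo` is
replaced by the Literature module declaring `GoodSS` (`Literature/NumberTheory/EllipticCurves/Rank1Residual/Predicates.lean`) —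
an F1Sign2 statement file does not import a Theses file. TWO-ENGINE TABLE `g6/TABLE-ssnorm-v1.tsv` 78d77eb0e2f893b3 (45/45 rows
+ 6 controls). REF2 v13 §3 pre-placement: Kuriya 2005 JNT 113 Thm 1.1/1.4 (norm cokernels of formal groups in ℤ_p-towers, any
p), Hazewinkel 1974 Thm 6.1, KT82 §8 — grade L14-loc IN-PRINT SPECIAL CASE, L14-glob / L14-glob′ IN-PRINT ASSEMBLY;
beyond-print theorem: no. REF2 v14 (a0bb009b2109c2fd, 20:39:10Z): L14-loc IN-PRINT SPECIAL CASE confirmed and sharpened (J_N =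
q_{N−1}(2) verbatim, q_n = Kitajima–Otsuki 2018 Prop 3.16 / Cor 3.20 = Kobayashi 8.12 rank polynomial at odd p; presentation at 2
printed Sprung 2012 Thm 2.2; KT82 Prop 8.15), L14-glob / L14-glob′ in-print assembly (Kramer 1981 Thm 1 + Remark ∘ L14-loc).
REF1-AUDIT-v1 §30 (ff0d73276419a055, 2026-08-27T21:38:02Z; evidence `HOME/REF1-data/b27/`): as-is rc 0, A1 rc 0 (carrier read-back:
`((layer N).map Tr_{N/N−1}).relIndex (layer (N−1))` = #coker Tr on E(ℚ_{2,N}) exactly, finite, model-independent, `N − 1` safe under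
`1 ≤ N`; `2 • x = 0 → x = 0` on Sel_{2^∞}(E/ℚ) = «Sel₂(E/ℚ) = 0»), BC7 CLEAN ×4, A2 page hits KT82 Prop 8.15 + remark p. 342 + Thm 8.17
[paper:url-f1c2eb36a995 p0036–0037] (side condition 3v(a₁) ≥ a(ω) = 2^N + 1 automatic) and Kramer 1981 Thm 1 / Remark p. 131 / Props 1,
2(a); verdicts L14-loc `SupersingularStepNormIndexAtTwo` SURVIVES (in-print special case), L14-loc′ in print, L14-glob
`SupersingularTowerSelmerFloorAtTwo` SURVIVES (in-print assembly), L14-glob′ `SupersingularFirstLayerSelmerRankAtTwo` SURVIVES (in-print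
assembly = Kramer's genus-theory remark; `inertEvenMultPrimes` correctly type-independent) — «file as typed (one file)». bears_on: `stmt-BirchSwinnertonDyer-19097`
(`SupersingularRankZeroAtTwo`; registered line `signed_halves_two`, stub `stub_pmFlatDataV9` local clauses; crux idea
«jacobsthal-norm-index-at-two» 77f7d9a4f19fb059 = evidence #53 on 19097).
-/

set_option autoImplicit false

open scoped NumberField

open WeierstrassCurve Literature.NumberTheory.EllipticCurves
  Literature.NumberTheory.EllipticCurves.Rank1Residual
  Literature.NumberTheory.EllipticCurves.Kobayashi2003 ZpExtension NumberField IsDedekindDomain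

open Literature.Barriers.BirchSwinnertonDyer (nRankAtLeast)

namespace Summit.BirchSwinnertonDyer.Rank1Residual.F1Sign2

/-! ## §1 Jacobsthal numbers (kernel-checked) -/

/-- The Jacobsthal numbers `J_0 = 0, J_1 = 1, J_{n+2} = J_{n+1} + 2 J_n`:
`0, 1, 1, 3, 5, 11, 21, 43, 85, …`; closed form `J_n = (2^n − (−1)^n)/3` (`three_mul_jacobsthal`). -/
def jacobsthal : ℕ → ℕ
  | 0 => 0
  | 1 => 1
  | n + 2 => jacobsthal (n + 1) + 2 * jacobsthal n

/-- `J_0 = 0`. -/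
@[simp] theorem jacobsthal_zero : jacobsthal 0 = 0 := rfl

/-- `J_1 = 1`. -/
@[simp] theorem jacobsthal_one : jacobsthal 1 = 1 := rfl

/-- The recursion `J_{n+2} = J_{n+1} + 2 J_n`. -/
theorem jacobsthal_add_two (n : ℕ) : jacobsthal (n + 2) = jacobsthal (n + 1) + 2 * jacobsthal n := rfl

/-- The first values (the seven measured levels `N = 1, …, 7` are `1, 1, 3, 5, 11, 21, 43`). -/
theorem jacobsthal_values :
    [jacobsthal 0, jacobsthal 1, jacobsthal 2, jacobsthal 3, jacobsthal 4, jacobsthal 5, jacobsthal 6,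
      jacobsthal 7, jacobsthal 8] = [0, 1, 1, 3, 5, 11, 21, 43, 85] := by
  decide

/-- Closed form: `3 J_n = 2^n − (−1)^n`. -/
theorem three_mul_jacobsthal : ∀ n : ℕ, (3 * jacobsthal n : ℤ) = 2 ^ n - (-1) ^ n
  | 0 => by simp
  | 1 => by simp
  | n + 2 => by
      have h₁ := three_mul_jacobsthal (n + 1)
      have h₀ := three_mul_jacobsthal n
      rw [jacobsthal_add_two]
      push_cast
      linear_combination h₁ + 2 * h₀

/-- `J_n` is odd for `n ≥ 1` (the printed parity: `(−1)^{i} = (Δ_min, 2)_{ℚ₂} = −1`, Kramer 1981 Prop. 4 /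
Dokchitser–Dokchitser 2011 Thm. 5, since `Δ_min ≡ 5 (mod 8)` at a supersingular `2`). -/
theorem odd_jacobsthal : ∀ n : ℕ, 1 ≤ n → Odd (jacobsthal n)
  | 0 => fun h => absurd h (by decide)
  | 1 => fun _ => by decide
  | n + 2 => fun _ => by
      rw [jacobsthal_add_two]
      exact (odd_jacobsthal (n + 1) (by omega)).add_even (even_two_mul _)

/-- `J_{n+1} + J_n = 2^n` (equivalently `r_m := J_{m+1}` solves `r_m = 2^m − r_{m−1}`, `r_0 = 1`: the rank
pattern forced by a two-generator Kobayashi/Sprung presentation `Ê(𝔪_N) = ℤ₂[G]c_N + ℤ₂[G]c_{N−1}` with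
`Tr c_{n+1} = a₂ c_n − c_{n−1}`). -/
theorem jacobsthal_succ_add : ∀ n : ℕ, jacobsthal (n + 1) + jacobsthal n = 2 ^ n
  | 0 => by simp
  | n + 1 => by
      have h := jacobsthal_succ_add n
      rw [jacobsthal_add_two, pow_succ]
      omega

/-! ## §2 The local law (candidate row L14-loc; in-print special case of [KramerTunnell1982, §8]) -/

/-- **L14-loc · `SupersingularStepNormIndexAtTwo`** (candidate `Prop`, grade IN-PRINT SPECIAL CASE, BC5 witness =
the two-engine table above). For `W/ℚ` (globally minimal) with good supersingular reduction at `2`, the cyclotomic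
`ℤ₂`-extension `κ` and the place `v ∋ 2`: for every `N ≥ 1` the trace `Tr_{N/N−1} : E(ℚ_{2,N}) → E(ℚ_{2,N−1})`
(tree: `localTraceOfEmb κ ι W (N−1) N` on `localLayerPointsOfEmb κ ι W N`, `ι = closureEmb ℚ_2`) has cokernel of
order exactly `2^{J_N}`. -/
def SupersingularStepNormIndexAtTwo : Prop :=
  ∀ (W : WeierstrassCurve ℚ) [W.IsElliptic] [W.IsGloballyMinimal], GoodSS W 2 →
  ∀ (κ : ZpExtension ℚ 2), κ.IsCyclotomic →
  ∀ (v : HeightOneSpectrum (𝓞 ℚ)), (2 : 𝓞 ℚ) ∈ v.asIdeal →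
  ∀ N : ℕ, 1 ≤ N →
    ((localLayerPointsOfEmb κ (closureEmb (K := ℚ) (v.adicCompletion ℚ)) W N).map
        (localTraceOfEmb κ (closureEmb (K := ℚ) (v.adicCompletion ℚ)) W (N - 1) N)).relIndex
      (localLayerPointsOfEmb κ (closureEmb (K := ℚ) (v.adicCompletion ℚ)) W (N - 1)) =
      2 ^ jacobsthal N

/-- **L14-loc′ · first layer only** (`N = 1`, `ℚ_{2,1} = ℚ₂(√2)`): the cokernel of `Tr : E(ℚ₂(√2)) → E(ℚ₂)` has
order `2` — Kramer 1981 Prop. 4 verbatim case `F = ℚ₂`, `v(d) = v(2) = 1` odd, `i = [F : ℚ₂] = 1`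
[corpus: paper:doi-10-1090-s0002-9947-1981-0597871-8 p0007]; the layer-`1` census of MEMO-desc §12 (censuses C/D). -/
def SupersingularFirstLayerNormIndexAtTwo : Prop :=
  ∀ (W : WeierstrassCurve ℚ) [W.IsElliptic] [W.IsGloballyMinimal], GoodSS W 2 →
  ∀ (κ : ZpExtension ℚ 2), κ.IsCyclotomic →
  ∀ (v : HeightOneSpectrum (𝓞 ℚ)), (2 : 𝓞 ℚ) ∈ v.asIdeal →
    ((localLayerPointsOfEmb κ (closureEmb (K := ℚ) (v.adicCompletion ℚ)) W 1).map
        (localTraceOfEmb κ (closureEmb (K := ℚ) (v.adicCompletion ℚ)) W 0 1)).relIndex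
      (localLayerPointsOfEmb κ (closureEmb (K := ℚ) (v.adicCompletion ℚ)) W 0) = 2

/-- The step law at `N = 1` is the first-layer law (`J_1 = 1`). -/
theorem firstLayer_of_step (h : SupersingularStepNormIndexAtTwo) : SupersingularFirstLayerNormIndexAtTwo := by
  intro W _ _ hss κ hκ v hv
  simpa using h W hss κ hκ v hv 1 le_rfl

/-! ## §3 The global corollary (candidate row L14-glob; in-print assembly Kramer 1981 Thm. 1 + `E(ℚ_{N−1})[2] = 0`) -/

/-- **L14-glob · `SupersingularTowerSelmerFloorAtTwo`** (candidate `Prop`, grade IN-PRINT ASSEMBLY): for `W/ℚ` with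
good supersingular reduction at `2` and the cyclotomic `ℤ₂`-extension `κ`, the `2^∞`-Selmer group of the `N`-th layer
`Sel_{2^∞}(E/ℚ_N)` (tree: `W.selmerLayer κ N`) contains a copy of `(ℤ/2)^{J_N}` — Matsuno's `rk₂ ≥ J_N`, tree
`Literature.Barriers.BirchSwinnertonDyer.nRankAtLeast` [cite: Matsuno2009, §2] — i.e.
`dim_{𝔽₂} Sel_{2^∞}(E/ℚ_N)[2] = dim_{𝔽₂} Sel₂(E/ℚ_N) ≥ J_N` (the two dimensions agree because `E(ℚ_N)[2] = 0`).
Unconditional (no `L`-value, no IMC): Kramer 1981 Thm. 1 at the step `ℚ_N/ℚ_{N−1}` with `E(ℚ_{N−1})[2] = 0` gives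
`dim Sel₂(E/ℚ_N) = Σ_v i_v + dim Φ + dim NS′ ≥ i_{v₂} = J_N`; his Remark [p0012] gives EQUALITY `= Σ_v i_v` when
`Sel₂(E/ℚ_{N−1}) = 0`. -/
def SupersingularTowerSelmerFloorAtTwo : Prop :=
  ∀ (W : WeierstrassCurve ℚ) [W.IsElliptic] [W.IsGloballyMinimal], GoodSS W 2 →
  ∀ (κ : ZpExtension ℚ 2), κ.IsCyclotomic → ∀ N : ℕ,
    nRankAtLeast (↥(W.selmerLayer κ N)) 2 (jacobsthal N)

/-- Unfolding: the floor is an injective `(ℤ/2)^{J_N} →+ Sel_{2^∞}(E/ℚ_N)`. -/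
theorem supersingularTowerSelmerFloorAtTwo_iff :
    SupersingularTowerSelmerFloorAtTwo ↔
      ∀ (W : WeierstrassCurve ℚ) [W.IsElliptic] [W.IsGloballyMinimal], GoodSS W 2 →
      ∀ (κ : ZpExtension ℚ 2), κ.IsCyclotomic → ∀ N : ℕ,
        ∃ f : (Fin (jacobsthal N) → ZMod 2) →+ ↥(W.selmerLayer κ N), Function.Injective f :=
  Iff.rfl

/-- The floor is unbounded up the tower: layer `N + 1` carries `rk₂ Sel ≥ 2^N − J_N = J_{N+1}`, in particular
`rk₂ Sel_{2^∞}(E/ℚ_{N+1}) ≥ k` for every `k ≤ J_{N+1}` (`nRankAtLeast.mono`). -/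
theorem nRankAtLeast_selmerLayer_of_le (h : SupersingularTowerSelmerFloorAtTwo)
    (W : WeierstrassCurve ℚ) [W.IsElliptic] [W.IsGloballyMinimal] (hss : GoodSS W 2)
    (κ : ZpExtension ℚ 2) (hκ : κ.IsCyclotomic) (N k : ℕ) (hk : k ≤ jacobsthal N) :
    nRankAtLeast (↥(W.selmerLayer κ N)) 2 k :=
  nRankAtLeast.mono hk (h W hss κ hκ N)

/-! ## §4 The exact first-layer count (candidate row L14-glob′; Kramer's genus theory [Kramer1981, Remark p. 131]) -/

/-- **L14-glob′ · `SupersingularFirstLayerSelmerRankAtTwo`** (candidate `Prop`, grade IN-PRINT ASSEMBLY — Kramer 1981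
Thm. 1 + Remark («if `S = 0` … `dim S′ = Σ i_v` … an analog of genus theory») + Props. 1, 2 (a), 4 + `E(ℚ(√2))[2] = 0`):
for `W/ℚ` globally minimal with good SUPERSINGULAR reduction at `2`, SEMISTABLE away from `2`, and `Sel₂(E/ℚ) = 0`
(typed: `Sel_{2^∞}(E/ℚ)` has no element of order `2`; the same thing because `E(ℚ)[2] = 0` at a supersingular `2`),
the first cyclotomic layer `ℚ_1 = ℚ(√2)` has EXACTLY
`rk₂ Sel_{2^∞}(E/ℚ(√2)) = dim_𝔽₂ Sel₂(E/ℚ(√2)) = 1 + #{ℓ ∥ N_E : ℓ ≡ ±3 (8), v_ℓ(Δ_min) even}` = `J_1 +` the tree's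
`(inertEvenMultPrimes W).ncard` (`F1Sign2.LayerOneNormIndexFloorAtTwo`): `∞` splits (`i_∞ = 0`), `i_2 = J_1 = 1`
(Prop. 4), odd `ℓ ≡ ±1 (8)` split (`0`), odd `ℓ ≡ ±3 (8)` inert: good `0`, multiplicative `[v_ℓ(Δ) even]`
(Props. 1, 2 (a)). `rk₂ M = k` is typed as `nRankAtLeast M 2 k ∧ ¬ nRankAtLeast M 2 (k+1)` (Matsuno's `rk₂`).
Falsifier = data ask D-desc-14 (expected 0 violations). For a rank-0 class this is the exact 2-descent size over
`ℚ(√2)`, i.e. `rank E^{(2)}(ℚ) + dim Ш(E/ℚ(√2))[2] = 1 + k₁` — the layer-1 descent input of `stub_pmMillerLower`. -/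
def SupersingularFirstLayerSelmerRankAtTwo : Prop :=
  ∀ (W : WeierstrassCurve ℚ) [W.IsElliptic] [W.IsGloballyMinimal], GoodSS W 2 →
  (∀ (ℓ : ℕ) (_ : Fact ℓ.Prime), ℓ ≠ 2 → W.HasGoodReductionAtPrime ℓ ∨ W.HasMultiplicativeReductionAtPrime ℓ) →
  ∀ (κ : ZpExtension ℚ 2), κ.IsCyclotomic →
  (∀ x : ↥(W.selmerLayer κ 0), 2 • x = 0 → x = 0) →
    nRankAtLeast (↥(W.selmerLayer κ 1)) 2 (1 + (inertEvenMultPrimes W).ncard) ∧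
      ¬ nRankAtLeast (↥(W.selmerLayer κ 1)) 2 (2 + (inertEvenMultPrimes W).ncard)

/-- The exact count implies the `N = 1` case of the tower floor (`J_1 = 1 ≤ 1 + k₁`) under its hypotheses. -/
theorem nRankAtLeast_one_of_firstLayerSelmerRank (h : SupersingularFirstLayerSelmerRankAtTwo)
    (W : WeierstrassCurve ℚ) [W.IsElliptic] [W.IsGloballyMinimal] (hss : GoodSS W 2)
    (hsemi : ∀ (ℓ : ℕ) (_ : Fact ℓ.Prime), ℓ ≠ 2 →
      W.HasGoodReductionAtPrime ℓ ∨ W.HasMultiplicativeReductionAtPrime ℓ)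
    (κ : ZpExtension ℚ 2) (hκ : κ.IsCyclotomic) (h0 : ∀ x : ↥(W.selmerLayer κ 0), 2 • x = 0 → x = 0) :
    nRankAtLeast (↥(W.selmerLayer κ 1)) 2 (jacobsthal 1) :=
  nRankAtLeast.mono (by simp) (h W hss hsemi κ hκ h0).1

end Summit.BirchSwinnertonDyer.Rank1Residual.F1Sign2
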